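import Mathlib
import Summits.MatrixMultiplication.MatrixMultiplication.Theses.LevelGradedCohnUmans

/-!
# `SnLevelDesigns` (stmt-MatrixMultiplication-7613), line `garnir-annihilator`:
# J1 `stub_topCone` — the cone lemma for the Bruhat-top shell element

Crux `Summit.MatrixMultiplication.MatrixMultiplication.Theses.LevelGradedCohnUmans.SnLevelDesigns`;
skeleton `Cruxes/SnLevelDesigns/Lines/garnir_annihilator.lean` (lead reshape 3, registered stub J1);
this file proves the registered stub `stub_topCone` verbatim (name + signature, tree-only
vocabulary) and lands `--supports stmt-MatrixMultiplication-7613`.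

The Bruhat-top shell element `sTop (n, j) = [j, j+1, …, n-1 | j-1, j-2, …, 0]` is, as a function
on positions, `a ↦ a + j` for `a < n - j` and `a ↦ n - 1 - a` for `a ≥ n - j` (this is the
`if … then … else …` value formula in the statement). If a permutation `q` of `Fin n` is
Bruhat-ABOVE `sTop` in the rank-matrix order, i.e. `#{a < I : q a < J} ≤ #{a < I : sTop a < J}` for
all `I, J`, then `q` agrees with `sTop` on the whole tail `a ≥ n - j`.

Proof (elementary finset counting, Mathlib only).
* (A) `tc_le_apply_of_lt`: with `I = n - j + r`, `J = j - r` the right-hand side is `0` (head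
  values are `≥ j`, the first `r` tail values are `≥ j - r`), hence so is the left-hand side:
  every position `b < n - j + r` has `q b ≥ j - r`.
* (B) `tc_apply_lt_of_eq` (pigeonhole): the tail position `a = n - j + r` (`r < j`) has
  `q a < j - r`, since otherwise `q` would map the `n - j + r + 1` positions `< n - j + r + 1`
  injectively into the `n - j + r` values `≥ j - r`.
* `stub_topCone`: (A) at `r + 1` gives `q a ≥ j - r - 1`, (B) gives `q a < j - r`, so
  `q a = j - r - 1 = n - 1 - a`.

Source for the rank-matrix (tableau) criterion of Bruhat order: Björner–Brenti, *Combinatorics of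
Coxeter groups* (2005), Thm 2.1.5; the statement here is purely combinatorial and self-contained.
-/

-- the problem path repeats `MatrixMultiplication` (summit = problem), as in every file of this line
set_option linter.dupNamespace false

namespace Summit.MatrixMultiplication.MatrixMultiplication.Theorems.SnLevelDesigns

/-- Step (A) of the cone lemma `stub_topCone`. If `q : Equiv.Perm (Fin n)` is rank-matrix-above
the shell element `sTop (n, j)` (hypothesis `hq`, with `sTop` unfolded to its value formula
`a ↦ if a < n - j then a + j else n - 1 - a`) and `j ≤ n`, then for every `r` no position
`b < n - j + r` carries a value `q b < j - r`. Indeed the comparison finset for `sTop` at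
`I = n - j + r`, `J = j - r` is empty (head values are `≥ j`, the first `r` tail values are
`≥ j - r`), so by `hq` the one for `q` is empty as well. -/
theorem tc_le_apply_of_lt {n j : ℕ} (hj : j ≤ n) (q : Equiv.Perm (Fin n))
    (hq : ∀ I J : ℕ,
      (Finset.univ.filter (fun a : Fin n => (a : ℕ) < I ∧ ((q a : Fin n) : ℕ) < J)).card ≤
        (Finset.univ.filter (fun a : Fin n =>
          (a : ℕ) < I ∧ (if (a : ℕ) < n - j then (a : ℕ) + j else n - 1 - (a : ℕ)) < J)).card)
    (r : ℕ) (b : Fin n) (hb : (b : ℕ) < n - j + r) : j - r ≤ ((q b : Fin n) : ℕ) := by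
  by_contra hlt
  rw [not_le] at hlt
  have hpos : 0 < (Finset.univ.filter
      (fun a : Fin n => (a : ℕ) < n - j + r ∧ ((q a : Fin n) : ℕ) < j - r)).card :=
    Finset.card_pos.mpr ⟨b, Finset.mem_filter.mpr ⟨Finset.mem_univ b, hb, hlt⟩⟩
  obtain ⟨x, hx⟩ := Finset.card_pos.mp (lt_of_lt_of_le hpos (hq (n - j + r) (j - r)))
  rw [Finset.mem_filter] at hx
  obtain ⟨-, hx1, hx2⟩ := hx
  have hxn := x.isLt
  split_ifs at hx2 with h <;> omega

/-- Step (B) of the cone lemma `stub_topCone` (pigeonhole). Under the conclusion of step (A)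
(`hA`: every position `b < n - j + r` has `q b ≥ j - r`, for all `r`), the tail position
`a = n - j + r` with `r < j ≤ n` has `q a < j - r`: otherwise `q` maps the `n - j + r + 1`
positions `< n - j + r + 1` injectively into the complement of the `j - r` values `< j - r`,
which has only `n - j + r` elements. -/
theorem tc_apply_lt_of_eq {n j : ℕ} (hj : j ≤ n) (q : Equiv.Perm (Fin n))
    (hA : ∀ (r : ℕ) (b : Fin n), (b : ℕ) < n - j + r → j - r ≤ ((q b : Fin n) : ℕ))
    {r : ℕ} (hr : r < j) (a : Fin n) (ha : (a : ℕ) = n - j + r) :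
    ((q a : Fin n) : ℕ) < j - r := by
  by_contra hge
  rw [not_lt] at hge
  have hmaps : ∀ b ∈ Finset.univ.filter (fun b : Fin n => (b : ℕ) < n - j + r + 1),
      q b ∈ (Finset.univ.filter (fun v : Fin n => (v : ℕ) < j - r))ᶜ := by
    intro b hb
    rw [Finset.mem_filter] at hb
    rw [Finset.mem_compl, Finset.mem_filter, not_and, not_lt]
    intro _
    by_cases hb' : (b : ℕ) < n - j + r
    · exact hA r b hb'
    · have hba : b = a := Fin.ext (by omega)
      rw [hba]
      exact hge
  have hcard := Finset.card_le_card_of_injOn ⇑q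
    (fun b hb => Finset.mem_coe.mpr (hmaps b (Finset.mem_coe.mp hb))) q.injective.injOn
  rw [Finset.card_compl, Fintype.card_fin, Fin.card_filter_val_lt, Fin.card_filter_val_lt,
    Nat.min_eq_right (by omega : n - j + r + 1 ≤ n), Nat.min_eq_right (by omega : j - r ≤ n)]
    at hcard
  omega

/-- **`stub_topCone`** (registered stub J1 of crux stmt-MatrixMultiplication-7613, line
`garnir-annihilator`; the cone lemma for the Bruhat-top shell element, statement `TopCone` of the
skeleton with `sTop` unfolded to its value formula, tree-only vocabulary). Let `j ≤ n` and let
`q : Equiv.Perm (Fin n)` be Bruhat-above `sTop (n, j) = (a ↦ a + j for a < n - j,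
a ↦ n - 1 - a for a ≥ n - j)` in the rank-matrix order: for all `I J`,
`#{a < I : q a < J} ≤ #{a < I : sTop a < J}`. Then `q a = n - 1 - a` for every tail position
`a ≥ n - j`. Proof: write `a = n - j + r` (`r < j`); step (A) `tc_le_apply_of_lt` at `r + 1`
gives `q a ≥ j - r - 1`, step (B) `tc_apply_lt_of_eq` gives `q a < j - r`, and
`j - r - 1 = n - 1 - a`. -/
theorem stub_topCone :
    ∀ (n j : ℕ), j ≤ n → ∀ q : Equiv.Perm (Fin n),
      (∀ I J : ℕ,
        (Finset.univ.filter (fun a : Fin n => (a : ℕ) < I ∧ ((q a : Fin n) : ℕ) < J)).card ≤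
          (Finset.univ.filter (fun a : Fin n =>
            (a : ℕ) < I ∧ (if (a : ℕ) < n - j then (a : ℕ) + j else n - 1 - (a : ℕ)) < J)).card) →
      ∀ a : Fin n, n - j ≤ (a : ℕ) → ((q a : Fin n) : ℕ) = n - 1 - (a : ℕ) := by
  intro n j hj q hq a ha
  have hA := tc_le_apply_of_lt hj q hq
  have han := a.isLt
  have hr : (a : ℕ) - (n - j) < j := by omega
  have hup := tc_apply_lt_of_eq hj q hA hr a (by omega)
  have hlow := hA ((a : ℕ) - (n - j) + 1) a (by omega)
  omega

end Summit.MatrixMultiplication.MatrixMultiplication.Theorems.SnLevelDesigns
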